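import Literature.Geometry.Lorentzian.StationaryOrbitSpaceManifold
import HarnessLib

/-!
# The projection `π : M → S` of a chronological stationary space-time is a smooth submersion
(Anderson 2000, §0: "`π : M → S` is a principle `ℝ`-bundle")

M. T. Anderson, *On stationary vacuum solutions to the Einstein equations*, Ann. Henri Poincaré 1
(2000), §0: "Then `S` is a smooth 3-manifold and the projection `π : M → S` is a principle
`ℝ`-bundle, with fiber `G`." With the smooth structure of `StationaryOrbitSpaceManifold.lean` on
the orbit space `S = OrbitSpace X` (slice charts), this file proves the differential-topological
content of "`π` is a bundle projection":

* `SliceData.exists_flow_eq_param_zero` — if `π y₀ = π p` then a flow time carries `y₀` to the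
  base point `p = param 0` of the slice at `p`;
* `SliceData.chart_orbitProj_eventuallyEq` — **local form of `π`**: near such a `y₀`, in the slice
  chart at `p`, `π` reads `y ↦ coord(θ(t₁, y))` (flow invariance of `π` and
  `chart_apply_orbitProj`);
* `IsStationaryKilling.contMDiff_orbitProj` — **`π` is `C^∞`** from `M` to `S` with its
  slice-chart smooth structure (Mathlib's `contMDiffAt_iff_target` and the local form);
* `SliceData.surjective_mfderiv_coord` — the transversal coordinate has surjective differential at
  the base point (`coord ∘ param = id` on the chart domain, chain rule);
* `IsStationaryKilling.surjective_mfderiv_orbitProj` — **`π` is a submersion**: its differential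
  is surjective at every point (local form, surjectivity of `d coord` and of the differential of a
  flow map, injectivity of the differential of a chart);
* `IsStationaryKilling.mfderiv_orbitProj_apply_self` — **`dπ(X) = 0`**: the Killing direction is
  vertical (`π` is constant along flow lines; chain rule);
* `Spacetime.IsStationaryKilling.contMDiff_orbitProj`, `….surjective_mfderiv_orbitProj` — the
  bundled four-dimensional forms (`π : M → S` a `C^∞` submersion onto the smooth 3-manifold `S`,
  model `𝓡 3`), under the hypotheses of `Anderson2000_completeStationaryVacuumFlat` that concern the
  group action.

Together with `exists_slice` (local sections `σ`, local triviality of the flow on tubes) and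
`orbitProj_preimage_singleton` (the fibres are the orbits, injective flow lines) this is the
bundle structure of `π` short of the word "principal". Everything is proved; no definitions, no
named facts.

## References

* M. T. Anderson, Ann. Henri Poincaré 1 (2000) 977–994, arXiv:gr-qc/0001091, §0 (key
  `Anderson2000`).
* J. M. Lee, *Introduction to Smooth Manifolds*, 2nd ed., GTM 218 (2012), Thm. 21.10 (quotient
  manifold theorem: `π` is a smooth submersion) (key `LeeSmoothManifolds2013`).
-/

noncomputable section

open Bundle Set Filter Function Manifold TopologicalSpace
open scoped ContDiff Topology Manifold

namespace Literature.Geometry.Lorentzian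

namespace LorentzianMetric

section Projection

variable {E : Type*} [NormedAddCommGroup E] [NormedSpace ℝ E] {M : Type*} [TopologicalSpace M]
  [ChartedSpace E M] {X : Π x : M, TangentSpace 𝓘(ℝ, E) x} {θ : ℝ × M → M}
  {F : Type*} [NormedAddCommGroup F] [NormedSpace ℝ F]

namespace SliceData

variable [IsManifold 𝓘(ℝ, E) ∞ M] [T2Space M] {p : M} (d : SliceData X θ F p)

/-- If `y₀` lies on the orbit of `p` (`π y₀ = π p`), some flow time carries `y₀` to the base point
`p = param 0` of the slice at `p`. [folklore] -/
theorem exists_flow_eq_param_zero (hX1 : CMDiff 1 (T% X))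
    (hθX : ∀ q, IsMIntegralCurve (fun t ↦ θ (t, q)) X) (hθ0 : ∀ q, θ (0, q) = q) {y₀ : M}
    (hy₀ : orbitProj X y₀ = orbitProj X p) : ∃ t₁ : ℝ, θ (t₁, y₀) = d.param 0 := by
  have hc : IsCompleteVectorField X := fun x ↦ ⟨fun t ↦ θ (t, x), hθX x, hθ0 x⟩
  obtain ⟨t₁, ht₁⟩ := (mem_stationaryOrbit_singleton_iff_exists_flow_eq hX1 hθX hθ0).1
    ((orbitProj_eq_iff X hX1 hc).1 hy₀)
  exact ⟨t₁, by rw [ht₁, d.param_zero]⟩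

variable [CompleteSpace E]

/-- **Local form of `π` in a slice chart.** If `θ(t₁, y₀) = p`, then near `y₀` the projection read
in the slice chart at `p` is `y ↦ coord(θ(t₁, y))`: `π y = π θ(t₁, y)` and `θ(t₁, y)` lies in the
tube for `y` near `y₀` (`chart_apply_orbitProj`). Anderson 2000, §0 (`π` is a bundle projection:
in a local trivialisation it is the projection to the slice). [cite: Anderson2000, §0] -/
theorem chart_orbitProj_eventuallyEq (hX1 : CMDiff 1 (T% X)) (hθc : Continuous θ)
    (hθX : ∀ q, IsMIntegralCurve (fun t ↦ θ (t, q)) X) (hθ0 : ∀ q, θ (0, q) = q) {y₀ : M}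
    {t₁ : ℝ} (ht₁ : θ (t₁, y₀) ∈ d.T) :
    (fun y ↦ d.chart hX1 hθX hθ0 (orbitProj X y)) =ᶠ[𝓝 y₀] fun y ↦ d.coord (θ (t₁, y)) := by
  have hθt : Continuous fun y : M ↦ θ (t₁, y) := hθc.comp (continuous_const.prodMk continuous_id)
  filter_upwards [(hθt.isOpen_preimage _ d.hTo).mem_nhds ht₁] with y hy
  rw [orbitProj_eq_of_mem X ⟨fun t ↦ θ (t, y), hθX y, hθ0 y, t₁, rfl⟩]
  exact d.chart_apply_orbitProj hX1 hθX hθ0 hy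

omit [IsManifold 𝓘(ℝ, E) ∞ M] [T2Space M] [CompleteSpace E] in
/-- **The transversal coordinate has surjective differential at the base point**: `coord ∘ param`
is the identity on the open chart domain `dom ∋ 0`, so `d(coord)_p ∘ d(param)_0 = id`
(`coord_param`, chain rule). [folklore] -/
theorem surjective_mfderiv_coord :
    Surjective (mfderiv 𝓘(ℝ, E) 𝓘(ℝ, F) d.coord (d.param 0)) := by
  have hparam : MDifferentiableAt 𝓘(ℝ, F) 𝓘(ℝ, E) d.param 0 :=
    (d.contMDiffOn_param.contMDiffAt (d.isOpen_dom.mem_nhds d.zero_mem_dom)).mdifferentiableAt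
      (by simp)
  have hcoord : MDifferentiableAt 𝓘(ℝ, E) 𝓘(ℝ, F) d.coord (d.param 0) :=
    (d.contMDiffOn_coord.contMDiffAt (d.hTo.mem_nhds (d.param_mem d.zero_mem_dom).2))
      |>.mdifferentiableAt (by simp)
  have hcomp := mfderiv_comp (0 : F) hcoord hparam
  have hid : mfderiv 𝓘(ℝ, F) 𝓘(ℝ, F) (d.coord ∘ d.param) 0 = ContinuousLinearMap.id ℝ F := by
    have h1 : (d.coord ∘ d.param) =ᶠ[𝓝 (0 : F)] _root_.id :=
      Filter.eventuallyEq_of_mem (d.isOpen_dom.mem_nhds d.zero_mem_dom)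
        (fun u hu ↦ d.coord_param hu)
    rw [h1.mfderiv_eq]
    exact mfderiv_id
  rw [hid] at hcomp
  intro w
  refine ⟨mfderiv 𝓘(ℝ, F) 𝓘(ℝ, E) d.param 0 w, ?_⟩
  have := congrArg (fun L : F →L[ℝ] F ↦ L w) hcomp
  exact this.symm

end SliceData

/-! ### `π` is a `C^∞` submersion -/

variable [FiniteDimensional ℝ E] [CompleteSpace E] [IsManifold 𝓘(ℝ, E) ∞ M] [T2Space M]
  {g : LorentzianMetric 𝓘(ℝ, E) ∞ M} [g.HasLeviCivita] {τ : TimeOrientation g}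
  [FiniteDimensional ℝ F]

omit [FiniteDimensional ℝ E] [CompleteSpace E] [IsManifold 𝓘(ℝ, E) ∞ M] [T2Space M]
  [g.HasLeviCivita] [FiniteDimensional ℝ F] in
/-- The differential of a flow map is surjective (its inverse is the differential of the reverse
flow map, `mfderiv_flow_neg_apply_mfderiv_flow`). Lee 2012, Thm. 9.12. [cite: LeeSmoothManifolds2013, Thm. 9.12] -/
theorem surjective_mfderiv_flow (hθ : ContMDiff (𝓘(ℝ, ℝ).prod 𝓘(ℝ, E)) 𝓘(ℝ, E) 2 θ)
    (hθ0 : ∀ p, θ (0, p) = p) (hθadd : ∀ t s p, θ (t, θ (s, p)) = θ (t + s, p)) (t : ℝ)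
    (y : M) : Surjective (mfderiv 𝓘(ℝ, E) 𝓘(ℝ, E) (fun q ↦ θ (t, q)) y) := by
  have key : ∀ p : M, Surjective (mfderiv 𝓘(ℝ, E) 𝓘(ℝ, E) (fun q ↦ θ (t, q)) (θ (-t, p))) := by
    intro p
    rw [show (fun q : M ↦ θ (t, q)) = fun q ↦ θ (-(-t), q) by simp only [neg_neg]]
    exact fun w ↦ ⟨_, PseudoRiemannianMetric.mfderiv_flow_neg_apply_mfderiv_flow hθ hθ0 hθadd
      (-t) p w⟩
  have := key (θ (t, y))
  rwa [flow_neg_apply_flow hθ0 hθadd] at this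

/-- **`π : M → S` is `C^∞`** for the slice-chart smooth structure of the orbit space
(`orbitSpaceChartedSpace`, `isManifold_orbitSpace`): about every `y₀`, in the slice chart at a
representative `p` of `π y₀`, `π` reads `y ↦ coord(θ(t₁, y))` (`SliceData.chart_orbitProj_eventuallyEq`),
a composite of `C^∞` maps. Anderson 2000, §0 ("the projection `π : M → S` is a principle
`ℝ`-bundle"); Lee 2012, Thm. 21.10. [cite: Anderson2000, §0] -/
theorem IsStationaryKilling.contMDiff_orbitProj (h : g.IsStationaryKilling τ X univ)
    (hchr : g.IsChronological τ) (hθ : ContMDiff (𝓘(ℝ, ℝ).prod 𝓘(ℝ, E)) 𝓘(ℝ, E) ∞ θ)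
    (hθ0 : ∀ p, θ (0, p) = p) (hθadd : ∀ t s p, θ (t, θ (s, p)) = θ (t + s, p))
    (hθX : ∀ p, IsMIntegralCurve (fun t ↦ θ (t, p)) X)
    (hF : Module.finrank ℝ F + 1 = Module.finrank ℝ E) :
    letI := h.orbitSpaceChartedSpace hchr (hθ.of_le (WithTop.coe_le_coe.mpr le_top)) hθ0 hθadd
      hθX hF
    ContMDiff 𝓘(ℝ, E) 𝓘(ℝ, F) ∞ (orbitProj X) := by
  letI := h.orbitSpaceChartedSpace hchr (hθ.of_le (WithTop.coe_le_coe.mpr le_top)) hθ0 hθadd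
    hθX hF
  have hθ2 : ContMDiff (𝓘(ℝ, ℝ).prod 𝓘(ℝ, E)) 𝓘(ℝ, E) 2 θ :=
    hθ.of_le (WithTop.coe_le_coe.mpr le_top)
  intro y₀
  rw [contMDiffAt_iff_target]
  refine ⟨(continuous_orbitProj X).continuousAt, ?_⟩
  -- the slice chart at the chosen representative `p` of `π y₀`
  set p : M := (orbitProj X y₀).out with hp
  set d : SliceData X θ F p := h.sliceDataAt hchr hθ2 hθ0 hθadd hθX hF p with hd
  have hpy : orbitProj X y₀ = orbitProj X p := (Quotient.out_eq (orbitProj X y₀)).symm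
  obtain ⟨t₁, ht₁⟩ := d.exists_flow_eq_param_zero h.contMDiff_one hθX hθ0 hpy
  have ht₁T : θ (t₁, y₀) ∈ d.T := by rw [ht₁]; exact (d.param_mem d.zero_mem_dom).2
  -- the target composite is, near `y₀`, `coord ∘ θ(t₁, ·)`
  have hloc := d.chart_orbitProj_eventuallyEq h.contMDiff_one hθ.continuous hθX hθ0 ht₁T
  have hθt : ContMDiff 𝓘(ℝ, E) 𝓘(ℝ, E) ∞ (fun y : M ↦ θ (t₁, y)) :=
    hθ.comp (contMDiff_const.prodMk contMDiff_id)
  have hG : ContMDiffAt 𝓘(ℝ, E) 𝓘(ℝ, F) ∞ (d.coord ∘ fun y : M ↦ θ (t₁, y)) y₀ :=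
    ContMDiffAt.comp (g := d.coord) (f := fun y : M ↦ θ (t₁, y)) y₀
      (d.contMDiffOn_coord.contMDiffAt (d.hTo.mem_nhds ht₁T)) hθt.contMDiffAt
  have heq : (extChartAt 𝓘(ℝ, F) (orbitProj X y₀) ∘ orbitProj X) =ᶠ[𝓝 y₀]
      fun y ↦ d.coord (θ (t₁, y)) := by
    refine Filter.EventuallyEq.trans (Filter.Eventually.of_forall fun y ↦ ?_) hloc
    simp only [comp_apply, extChartAt, OpenPartialHomeomorph.extend_coe, modelWithCornersSelf_coe,
      CompTriple.comp_eq]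
    rfl
  exact hG.congr_of_eventuallyEq heq

/-- **`π : M → S` is a submersion**: its differential is surjective at every point. In the slice
chart at a representative `p` of `π y₀` (with `θ(t₁, y₀) = p`), `d(chart ∘ π)_{y₀} =
d(coord)_p ∘ d(θ_{t₁})_{y₀}` is surjective (`surjective_mfderiv_coord`,
`surjective_mfderiv_flow`), and `d(chart)` is injective. Anderson 2000, §0 ("`π : M → S` is a
principle `ℝ`-bundle"); Lee 2012, Thm. 21.10. [cite: Anderson2000, §0] -/
theorem IsStationaryKilling.surjective_mfderiv_orbitProj (h : g.IsStationaryKilling τ X univ)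
    (hchr : g.IsChronological τ) (hθ : ContMDiff (𝓘(ℝ, ℝ).prod 𝓘(ℝ, E)) 𝓘(ℝ, E) ∞ θ)
    (hθ0 : ∀ p, θ (0, p) = p) (hθadd : ∀ t s p, θ (t, θ (s, p)) = θ (t + s, p))
    (hθX : ∀ p, IsMIntegralCurve (fun t ↦ θ (t, p)) X)
    (hF : Module.finrank ℝ F + 1 = Module.finrank ℝ E) (y₀ : M) :
    letI := h.orbitSpaceChartedSpace hchr (hθ.of_le (WithTop.coe_le_coe.mpr le_top)) hθ0 hθadd
      hθX hF
    Surjective (mfderiv 𝓘(ℝ, E) 𝓘(ℝ, F) (orbitProj X) y₀) := by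
  letI := h.orbitSpaceChartedSpace hchr (hθ.of_le (WithTop.coe_le_coe.mpr le_top)) hθ0 hθadd
    hθX hF
  haveI := h.isManifold_orbitSpace hchr hθ hθ0 hθadd hθX hF
  have hθ2 : ContMDiff (𝓘(ℝ, ℝ).prod 𝓘(ℝ, E)) 𝓘(ℝ, E) 2 θ :=
    hθ.of_le (WithTop.coe_le_coe.mpr le_top)
  set p : M := (orbitProj X y₀).out with hp
  set d : SliceData X θ F p := h.sliceDataAt hchr hθ2 hθ0 hθadd hθX hF p with hd
  have hpy : orbitProj X y₀ = orbitProj X p := (Quotient.out_eq (orbitProj X y₀)).symm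
  obtain ⟨t₁, ht₁⟩ := d.exists_flow_eq_param_zero h.contMDiff_one hθX hθ0 hpy
  have ht₁T : θ (t₁, y₀) ∈ d.T := by rw [ht₁]; exact (d.param_mem d.zero_mem_dom).2
  have hloc := d.chart_orbitProj_eventuallyEq h.contMDiff_one hθ.continuous hθX hθ0 ht₁T
  -- differentiability of the pieces
  have hπ : MDifferentiableAt 𝓘(ℝ, E) 𝓘(ℝ, F) (orbitProj X) y₀ :=
    ((h.contMDiff_orbitProj hchr hθ hθ0 hθadd hθX hF) y₀).mdifferentiableAt (by simp)
  have hchart_eq : chartAt F (orbitProj X y₀) = d.chart h.contMDiff_one hθX hθ0 := rfl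
  have hmem : orbitProj X y₀ ∈ (d.chart h.contMDiff_one hθX hθ0).source := by
    rw [hpy]; exact d.mem_chart_source h.contMDiff_one hθX hθ0
  have hch : (d.chart h.contMDiff_one hθX hθ0).MDifferentiable 𝓘(ℝ, F) 𝓘(ℝ, F) :=
    hchart_eq ▸ mdifferentiable_chart (orbitProj X y₀)
  have hθt : ContMDiff 𝓘(ℝ, E) 𝓘(ℝ, E) ∞ (fun y : M ↦ θ (t₁, y)) :=
    hθ.comp (contMDiff_const.prodMk contMDiff_id)
  have hθd : MDifferentiableAt 𝓘(ℝ, E) 𝓘(ℝ, E) (fun y : M ↦ θ (t₁, y)) y₀ :=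
    hθt.contMDiffAt.mdifferentiableAt (by simp)
  have hcd : MDifferentiableAt 𝓘(ℝ, E) 𝓘(ℝ, F) d.coord (θ (t₁, y₀)) :=
    (d.contMDiffOn_coord.contMDiffAt (d.hTo.mem_nhds ht₁T)).mdifferentiableAt (by simp)
  -- the two expressions of `d(chart ∘ π)_{y₀}`
  have h1 : mfderiv 𝓘(ℝ, E) 𝓘(ℝ, F) (fun y ↦ d.chart h.contMDiff_one hθX hθ0 (orbitProj X y)) y₀ =
      (mfderiv 𝓘(ℝ, F) 𝓘(ℝ, F) (d.chart h.contMDiff_one hθX hθ0) (orbitProj X y₀)).comp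
        (mfderiv 𝓘(ℝ, E) 𝓘(ℝ, F) (orbitProj X) y₀) :=
    mfderiv_comp y₀ (hch.mdifferentiableAt hmem) hπ
  have h2 : mfderiv 𝓘(ℝ, E) 𝓘(ℝ, F) (fun y ↦ d.chart h.contMDiff_one hθX hθ0 (orbitProj X y)) y₀ =
      (mfderiv 𝓘(ℝ, E) 𝓘(ℝ, F) d.coord (θ (t₁, y₀))).comp
        (mfderiv 𝓘(ℝ, E) 𝓘(ℝ, E) (fun y : M ↦ θ (t₁, y)) y₀) := by
    rw [hloc.mfderiv_eq]
    exact mfderiv_comp y₀ hcd hθd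
  -- surjectivity of `d(coord) ∘ d(θ_{t₁})`
  have hsurj : Surjective ((mfderiv 𝓘(ℝ, E) 𝓘(ℝ, F) d.coord (θ (t₁, y₀))).comp
      (mfderiv 𝓘(ℝ, E) 𝓘(ℝ, E) (fun y : M ↦ θ (t₁, y)) y₀)) := by
    rw [ContinuousLinearMap.coe_comp]
    refine Surjective.comp ?_ (surjective_mfderiv_flow hθ2 hθ0 hθadd t₁ y₀)
    rw [ht₁]
    exact d.surjective_mfderiv_coord
  -- conclude by injectivity of `d(chart)`
  intro ζ
  obtain ⟨v, hv⟩ := hsurj (mfderiv 𝓘(ℝ, F) 𝓘(ℝ, F) (d.chart h.contMDiff_one hθX hθ0)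
    (orbitProj X y₀) ζ)
  refine ⟨v, hch.mfderiv_injective hmem ?_⟩
  have := congrArg (fun L ↦ L v) (h2.symm.trans h1)
  simp only [ContinuousLinearMap.coe_comp, comp_apply] at this hv
  rw [← this]
  exact hv

/-! ### The kernel of `dπ` is the Killing direction -/

/-- **`dπ` kills the Killing field**: `dπ_y(X y) = 0`, since `π` is constant along the flow line
`t ↦ θ(t, y)` whose velocity at `t = 0` is `X y` (chain rule). Anderson 2000, §0 (the vertical
subspace `⟨X⟩` of the bundle `π : M → S`). [cite: Anderson2000, §0] -/
theorem IsStationaryKilling.mfderiv_orbitProj_apply_self (h : g.IsStationaryKilling τ X univ)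
    (hchr : g.IsChronological τ) (hθ : ContMDiff (𝓘(ℝ, ℝ).prod 𝓘(ℝ, E)) 𝓘(ℝ, E) ∞ θ)
    (hθ0 : ∀ p, θ (0, p) = p) (hθadd : ∀ t s p, θ (t, θ (s, p)) = θ (t + s, p))
    (hθX : ∀ p, IsMIntegralCurve (fun t ↦ θ (t, p)) X)
    (hF : Module.finrank ℝ F + 1 = Module.finrank ℝ E) (y : M) :
    letI := h.orbitSpaceChartedSpace hchr (hθ.of_le (WithTop.coe_le_coe.mpr le_top)) hθ0 hθadd
      hθX hF
    mfderiv 𝓘(ℝ, E) 𝓘(ℝ, F) (orbitProj X) y (X y) = 0 := by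
  letI := h.orbitSpaceChartedSpace hchr (hθ.of_le (WithTop.coe_le_coe.mpr le_top)) hθ0 hθadd
    hθX hF
  -- the flow line through `y` and its velocity at `0`
  have hγ := hθX y 0
  have hπd : MDifferentiableAt 𝓘(ℝ, E) 𝓘(ℝ, F) (orbitProj X) (θ (0, y)) :=
    ((h.contMDiff_orbitProj hchr hθ hθ0 hθadd hθX hF) _).mdifferentiableAt (by simp)
  have hcomp := hπd.hasMFDerivAt.comp 0 hγ
  -- `π` is constant along the flow line
  have hconst : (orbitProj X ∘ fun t ↦ θ (t, y)) = fun _ ↦ orbitProj X y := by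
    funext t
    exact (orbitProj_eq_of_mem X ⟨fun t ↦ θ (t, y), hθX y, hθ0 y, t, rfl⟩).symm
  rw [hconst] at hcomp
  have h0 : HasMFDerivAt 𝓘(ℝ, ℝ) 𝓘(ℝ, F) (fun _ : ℝ ↦ orbitProj X y) 0
      (0 : TangentSpace 𝓘(ℝ, ℝ) (0 : ℝ) →L[ℝ] TangentSpace 𝓘(ℝ, F) (orbitProj X y)) :=
    hasMFDerivAt_const _ _
  have heq := hcomp.mfderiv.symm.trans h0.mfderiv
  dsimp only at heq
  rw [hθ0] at heq
  have := congrArg (fun L ↦ L (1 : ℝ)) heq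
  have h1 : (mfderiv 𝓘(ℝ, E) 𝓘(ℝ, F) (orbitProj X) y) ((1 : ℝ) • X y) = 0 := this
  rwa [one_smul] at h1

end Projection

end LorentzianMetric

/-! ### The bundled form -/

namespace Spacetime

universe u

variable {𝓢 : Spacetime.{u} 4} [𝓢.metric.HasLeviCivita]
  {X : Π x : 𝓢.carrier, TangentSpace (𝓡 4) x}

/-- `dim ℝ³ + 1 = dim ℝ⁴`. [folklore] -/
private lemma finrank_three_add_one' :
    Module.finrank ℝ (EuclideanSpace ℝ (Fin 3)) + 1 =
      Module.finrank ℝ (EuclideanSpace ℝ (Fin 4)) := by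
  simp [finrank_euclideanSpace]

/-- **Anderson 2000, §0, for a bundled spacetime: `π : M → S` is `C^∞`** onto the smooth orbit
3-manifold of a chronological stationary spacetime (slice-chart structure
`Spacetime.IsStationaryKilling.orbitSpaceChartedSpace`). [cite: Anderson2000, §0] -/
theorem IsStationaryKilling.contMDiff_orbitProj (hX : 𝓢.IsStationaryKilling X univ)
    (hchr : 𝓢.metric.IsChronological 𝓢.timeOrientation) :
    letI := hX.orbitSpaceChartedSpace hchr
    ContMDiff (𝓡 4) (𝓡 3) ∞ (orbitProj X) :=
  LorentzianMetric.IsStationaryKilling.contMDiff_orbitProj hX hchr hX.contMDiff_flow hX.flow_zero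
    hX.flow_add hX.isMIntegralCurve_flow finrank_three_add_one'

/-- **Anderson 2000, §0, for a bundled spacetime: `π : M → S` is a submersion** (surjective
differential at every event). [cite: Anderson2000, §0] -/
theorem IsStationaryKilling.surjective_mfderiv_orbitProj (hX : 𝓢.IsStationaryKilling X univ)
    (hchr : 𝓢.metric.IsChronological 𝓢.timeOrientation) (y : 𝓢.carrier) :
    letI := hX.orbitSpaceChartedSpace hchr
    Function.Surjective (mfderiv (𝓡 4) (𝓡 3) (orbitProj X) y) :=
  LorentzianMetric.IsStationaryKilling.surjective_mfderiv_orbitProj hX hchr hX.contMDiff_flow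
    hX.flow_zero hX.flow_add hX.isMIntegralCurve_flow finrank_three_add_one' y

end Spacetime

end Literature.Geometry.Lorentzian

end
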